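import Summits.QuantumFields.BalabanUV.Beta.FP.NestedStepLawTorusTransportedRowsGradedLevelZeroSymULowClosedLamW2
import Summits.QuantumFields.BalabanUV.Beta.FP.PeriodisedSymCompositeIndexWardTwo

/-!
# `BalabanUV.Beta.FP.NestedStepLawTorusTransportedRowsGradedLevelZeroSymULowClosedLamW2Q2` — road «FP» for binder row D1, ROUTE T, presentation T-β, option (δ)
# «LIFT ∕ GRADED» (R-FP-54′), (J-a) (β) × (α) AT ORDER 2, LEVEL-0 STOREY AT `d = 3`: **THE GRADED DOOR AT THE (III′) LITERAL, LEVEL 0, WITH THE SECOND-ORDER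
# AVERAGING TABLES BOUND AND `q2` DISCHARGED BY TERM** = U20 `…LevelZeroSymULowClosedLamW2` (p339288) at `d = 3` with the OWNER d1-p3 g22's bindings
# (answer to Q-d1leaf02-g22-1, [D1P3-G22-ONLINE]): `Q₁₂ w w′ := −c₀ • Σ_b Σ_{b′} (w b·w′ b′) • Q₁₂^{b,b′}` (my B1∕B2 `PeriodisedSymBorderT2IndexWard(Snd)`: the
# second-bond-periodised bi-member of an1's row border table `symVh₂SAn1 3 Lc` on `F = fine Lc M′`; JA-TABLE v1.5 Δ1's weight `cB∕cVH² = −c₀`) and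
# `Q₂₂ w w′ := −c₁ • Σ_{a′,a″} (w̄ a′·w̄′ a″) • Q₂₂^{a′,a″} + Σ_{a′} (θ₀·((Q₁₁ w)·w′) a′) • Q₂₁^{a′}` (the same bi-member on `M′` along the transported directions
# `w̄ = θ₀•Q₁₀ w`, plus the average map's second jet against the coarse first-order member); the binder `q2` is REMOVED — supplied inside by my
# `PeriodisedSymCompositeIndexWardTwo.torus_q2_sym_letter` (level `j := 0`) followed by the displayed NAMING `h𝔔′₂` of the one-shot literal's second composite
# averaging jet (bi-member summands along `h′ = h + Dλ`, the average map's second-jet summand UN-SHIFTED — the letter's located (★), the OWNER's (TN) word).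
# AFTER IT THE (J-a) (β) DOOR AT LEVEL 0 DISPLAYS ONLY: `a1 a2 c2 d2 t2` (Ward ∕ covariance rows between PINNED tables), `hdead`, `hGt`, `hfμ′ hcoarse′`, the
# weight letters `w` (Λ) ∕ `N` (colour), namings and defining equations.  Proof = ONE TERM.

WHAT.  ONE theorem `secondVar_oneShot_nestedStepLaw_torus_transported_graded_rows_levelZero_sym_uLow_closed_lam_w2_q2` = U20's theorem at `d = 3` (every
`d + 1` read `3 + 1`) with: NEW binders `hW₁₂` (B1's bi-family on `F`), `Q₁₂ : (bonds → ℝ) → (bonds → ℝ) → Matrix` + `hQ₁₂`, `hW₂₂` (the bi-family on `M′`),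
`Q₂₂` + `hQ₂₂` (the two summands VERBATIM as ruled), `h𝔔′₂` (the naming); U20's free matrices `Q₁₂ Q₂₂` become `Q₁₂ h h`, `Q₂₂ h h` in `h𝔔₂ t2 c2 d2` and in the
conclusion; the binder `q2` REMOVED (`(torus_q2_sym_letter …).trans h𝔔′₂`).  [folklore] composition BY NAME; nothing of an1's ∕ an2's ∕ the OWNER's restated;
no `def`, no `def … : Prop`, nothing cited, 0 sorry.

WHAT THIS DOES NOT SAY (the dictionary's ∕ the OWNER's): whether the (III′) record's order-2 AVERAGING tables along `h ⊗ h` ARE these bi-members at these weights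
(an2's JA-TABLE v1.5 Δ1 ∕ the OWNER's ruling — DISPLAYED bindings `hQ₁₂ hQ₂₂`), and whether the one-shot literal's second composite averaging jet IS the name
`𝔔′₂` with the average map's second-jet summand un-shifted ((★) of the letter) — displayed, not asserted.  What STAYS displayed: `a1 a2` (graded Ward rows),
`c2 d2` (insertion-table covariance at order 2 — the border family's FLUCTUATION-LEG law at order 2, JA-TABLE v1.5 Δ4), `t2`, `hdead`, `hGt`, `hfμ′ hcoarse′`.

HONEST DEPENDENCY (page 1, mandatory): continuum YM on T⁴ ⇐ BetaPertH ∧ nine spine estimates (0/9 proved); BetaPertH ⇐ (D1) ∧ (D4) ∧ CAP+tail;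
G-an2-4 gates asym, D1 and NE2/3/4.  HONEST FRAMING (cell contract, verbatim): «discharging `BetaPertH` makes Bałaban's UV stability UNCONDITIONAL —
a real constructive-QFT result; it is NOT the continuum limit and NOT the Clay problem.»  ABSOLUTE RULE (cell charter, verbatim): «No internally-minted
statement may enter as a cited fact. Every hypothesis is either kernel-proved in this package or a verbatim quotation of a PUBLISHED theorem with page
reference. The manuscript(s) under audit are NOT citable for their own disputed steps — they are the thing under adjudication; programme-internal
(2001/route/tribunal) claims are never citable.»  0 estimates; 0∕4 row-D1 binders; NOT (T-ID)∕(T-β) complete, NOT (J-a) complete, NOT SDF, NOT D1, NOT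
BetaPertH, NOT continuum, NOT Clay.  Road «FP», D1 formalisation swarm leaf-02 (b2b-balaban-beta-d1-formalise-leaf-02) gen 22, 2026-08-22.  No existing file
touched.
-/

noncomputable section

open scoped BigOperators Matrix

namespace Summit.QuantumFields.BalabanUV.Beta.FP.NestedStepLawTorusTransportedRowsGradedLevelZeroSymULowClosedLamW2Q2

open Matrix Finset
open Literature.Probability.LatticeModels (Torus.proj)
open Literature.MathematicalPhysics.QuantumFieldTheory.Balaban1983to89
open Literature.MathematicalPhysics.QuantumFieldTheory.Balaban1983to89.Beta
open Literature.MathematicalPhysics.QuantumFieldTheory.Balaban1983to89.Beta.Composition (kkt)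
open Literature.MathematicalPhysics.QuantumFieldTheory.Balaban1983to89.Beta.CompositionSingular (effForm flucCov minOp minOpL)
open Literature.MathematicalPhysics.QuantumFieldTheory.LatticeForm (quo)
open B5Prop11Plancherel (fine)
open B6Lemma24Torus (pbox mem_pbox)
open AffineAveraging (Site box toSite unitVec)
open AveragingContoursRooted (ctr ctrOff ctrOff_mem_box)
open SymAveragingHessianCounts (symVhSAt)
open OneStepResolventKernel (Fib KInv)
open InterLevelTransport (SLam)
open BalabanStepJets (lamCoeffOf)
open Summit.QuantumFields.BalabanUV.Beta.SymAveragingHessianCounts (symHessFFAt)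
open Summit.QuantumFields.BalabanUV.Beta.BorderedHessian (bhKStepAt stepScale)
open Summit.QuantumFields.BalabanUV.Beta.DshAn1 (Dsh)
open Summit.QuantumFields.BalabanUV.Beta.SymShiftedSpread (bhKStepSh)
open Summit.QuantumFields.BalabanUV.Beta.D1BFx.LogDetSecondVariation (secondVar)
open Summit.QuantumFields.BalabanUV.Beta.FP.KernelPeriodisationFib (Idx perF)
open Summit.QuantumFields.BalabanUV.Beta.FP.KernelPeriodisationFibLoc (dper)
open Summit.QuantumFields.BalabanUV.Beta.FP.TorusGaugeCovariance (tdelta tgrad)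
open Summit.QuantumFields.BalabanUV.Beta.FP.TorusGaugeCovarianceCoarse (coarsePt tgradBlock)
open Summit.QuantumFields.BalabanUV.Beta.FP.TorusCombRows (Res combRowsT combBondT)
open Summit.QuantumFields.BalabanUV.Beta.FP.TorusCombNestedBasis (resBigEquiv)
open Summit.QuantumFields.BalabanUV.Beta.GAN24.FineReadoutCauchyFrame (toSite_mem_range)
open StepJetData (wilsonA)
open Summit.QuantumFields.BalabanUV.Beta.FP.NestedStepLawTorusTransportedRowsGradedLevelZeroSymULowClosedLamW2 (secondVar_oneShot_nestedStepLaw_torus_transported_graded_rows_levelZero_sym_uLow_closed_lam_w2)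
open Summit.QuantumFields.BalabanUV.Beta.FP.PeriodisedSymCompositeIndexWardTwo (torus_q2_sym_letter)
open Summit.QuantumFields.BalabanUV.Beta.SymSecondOrderTablesAn1 (symVh₂SAn1)
open ExpKernelCalculus (MKer)
open B4TorusKernel.MultiPeriod (translate)
open WilsonBiStencil (wilsonW₂)
open WilsonVertex2Sym (wsym22)

variable (M' : Fin (3 + 1) → ℕ) [∀ μ, NeZero (M' μ)] {Lc : ℕ} [NeZero Lc]

set_option synthInstance.maxSize 1024 in
/-- [folklore] **THE GRADED DOOR AT THE (III′) LITERAL (uLow BOTTOM, SOCKETS CLOSED), LEVEL 0, `d = 3`, SECOND-ORDER FORM AND AVERAGING TABLES BOUND: `k2 hH₂t q2`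
DISCHARGED BY TERM; displayed only `a1 a2 c2 d2 t2 hdead hGt hfμ′ hcoarse′` + namings.**  U20's theorem at `d = 3` with the fine ∕ coarse order-2 insertion tables
`Q₁₂ Q₂₂` bound by `hQ₁₂ hQ₂₂` (the OWNER d1-p3 g22's ruling: `−c₀ •` ∕ `−c₁ •` the second-bond-periodised `symVh₂SAn1` bi-members, the coarse one along
`w̄ = θ₀•Q₁₀ w` plus the average map's second jet `θ₀·(Q₁₁ w)·w′` against `Q₂₁^{a′}`), the one-shot literal's second composite averaging jet NAMED by `h𝔔′₂`,
and the binder `q2` REMOVED — supplied inside by `torus_q2_sym_letter` at level `0`.  Conclusion VERBATIM U20's ∕ the (III′) call's at level 0 (`d = 3`). -/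
theorem secondVar_oneShot_nestedStepLaw_torus_transported_graded_rows_levelZero_sym_uLow_closed_lam_w2_q2 (hM' : ∀ i, Lc ∣ M' i)
    {κ : Type*} [Fintype κ] [DecidableEq κ] (pμ' : κ → ↥(pbox M')) (mμ' : κ → Fin (3 + 1))
    (hfμ' : Function.Injective (fun a : κ => ((pμ' a, Sum.inr (mμ' a)) : Idx M' (Fib 3))))
    (hcoarse' : ∀ (s : ↥(pbox M')) (m : Fin (3 + 1)),
      ((s, Sum.inr m) : Idx M' (Fib 3)) ∈ Set.range (fun a : κ => ((pμ' a, Sum.inr (mμ' a)) : Idx M' (Fib 3))) ↔ Torus.proj Lc (s : Site (3 + 1)) = 0)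
    -- the torus objects of record, by defining equations
    {H₀ : Matrix (↥(pbox (fine Lc M')) × Fin (3 + 1)) (↥(pbox (fine Lc M')) × Fin (3 + 1)) ℝ}
    {Q₁₀ : Matrix (↥(pbox M') × Fin (3 + 1)) (↥(pbox (fine Lc M')) × Fin (3 + 1)) ℝ}
    {τ₁ : Matrix (Res (ctr (3 + 1) Lc) Lc (fine Lc M')) (↥(pbox (fine Lc M')) × Fin (3 + 1)) ℝ}
    {τ₂ : Matrix (Res (ctr (3 + 1) Lc) Lc M') (↥(pbox M') × Fin (3 + 1)) ℝ}
    {D₁ : Matrix (↥(pbox (fine Lc M')) × Fin (3 + 1)) (Res (ctr (3 + 1) Lc) Lc (fine Lc M')) ℝ}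
    {D₂ : Matrix (↥(pbox (fine Lc M')) × Fin (3 + 1)) (Res (ctr (3 + 1) Lc) Lc M') ℝ}
    {Dbar : Matrix (↥(pbox M') × Fin (3 + 1)) (Res (ctr (3 + 1) Lc) Lc M') ℝ}
    {P : Matrix (Res (ctr (3 + 1) Lc) Lc M' ⊕ Res (ctr (3 + 1) Lc) Lc (fine Lc M')) (↥(pbox (fine Lc M')) × Fin (3 + 1)) ℝ}
    (hH₀ : H₀ = (perF (fine Lc M') (bhKStepSh 3 Lc (Dsh Lc) 0)).submatrix
        (fun b : ↥(pbox (fine Lc M')) × Fin (3 + 1) => ((b.1, Sum.inl b.2) : Idx (fine Lc M') (Fib 3)))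
        (fun b : ↥(pbox (fine Lc M')) × Fin (3 + 1) => ((b.1, Sum.inl b.2) : Idx (fine Lc M') (Fib 3))))
    (hQ₁₀ : Q₁₀ = (perF (fine Lc M') (bhKStepSh 3 Lc (Dsh Lc) 0)).submatrix
        (fun a : ↥(pbox M') × Fin (3 + 1) => ((coarsePt M' Lc a.1, Sum.inr a.2) : Idx (fine Lc M') (Fib 3)))
        (fun b : ↥(pbox (fine Lc M')) × Fin (3 + 1) => ((b.1, Sum.inl b.2) : Idx (fine Lc M') (Fib 3))))
    (hτ₁ : τ₁ = (combRowsT (ctr (3 + 1) Lc) Lc (fine Lc M')).submatrix id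
        (fun b : ↥(pbox (fine Lc M')) × Fin (3 + 1) => ((b.1, Sum.inl b.2) : Idx (fine Lc M') (Fib 3))))
    (hτ₂ : τ₂ = (combRowsT (ctr (3 + 1) Lc) Lc M').submatrix id (fun b : ↥(pbox M') × Fin (3 + 1) => ((b.1, Sum.inl b.2) : Idx M' (Fib 3))))
    (hD₁ : D₁ = (tgrad (fine Lc M')).submatrix (fun b : ↥(pbox (fine Lc M')) × Fin (3 + 1) => ((b.1, Sum.inl b.2) : Idx (fine Lc M') (Fib 3)))
        (Subtype.val : Res (ctr (3 + 1) Lc) Lc (fine Lc M') → ↥(pbox (fine Lc M'))))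
    (hD₂ : D₂ = (tgradBlock M' Lc).submatrix (fun b : ↥(pbox (fine Lc M')) × Fin (3 + 1) => ((b.1, Sum.inl b.2) : Idx (fine Lc M') (Fib 3)))
        (Subtype.val : Res (ctr (3 + 1) Lc) Lc M' → ↥(pbox M')))
    (hDbar : Dbar = Matrix.of fun (a : ↥(pbox M') × Fin (3 + 1)) (t : Res (ctr (3 + 1) Lc) Lc M') =>
        stepScale 3 Lc 0 * (((box (3 + 1) Lc).card : ℝ) * tgrad M' (a.1, Sum.inl a.2) t.1))
    (hP : P = (combRowsT ((Lc : ℤ) • ctr (3 + 1) Lc + ctr (3 + 1) Lc) (Lc * Lc) (fine Lc M')).submatrix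
        (resBigEquiv Lc Lc (ctr (3 + 1) Lc) (ctr (3 + 1) Lc) M' (Nat.pos_of_ne_zero (NeZero.ne Lc)) (toSite_mem_range (ctrOff_mem_box (Nat.one_le_iff_ne_zero.mpr (NeZero.ne Lc))))
          (Nat.pos_of_ne_zero (NeZero.ne Lc)) (toSite_mem_range (ctrOff_mem_box (Nat.one_le_iff_ne_zero.mpr (NeZero.ne Lc))))).symm
        (fun b : ↥(pbox (fine Lc M')) × Fin (3 + 1) => ((b.1, Sum.inl b.2) : Idx (fine Lc M') (Fib 3))))
    -- the displayed jets: averaging (both levels), block covariance, generators (fine and coarse), Ward witnesses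
    {Q₂₀ : Matrix κ (↥(pbox M') × Fin (3 + 1)) ℝ}
    (hQ₂₀ : Q₂₀ = (perF M' (bhKStepSh 3 Lc (Dsh Lc) 1)).submatrix (fun a : κ => ((pμ' a, Sum.inr (mμ' a)) : Idx M' (Fib 3)))
        (fun b : ↥(pbox M') × Fin (3 + 1) => ((b.1, Sum.inl b.2) : Idx M' (Fib 3))))
    -- leaf-02's ORDER-1 ROWS ALONG A DIRECTION `h` AND THE GAUGE PARAMETER `λ` OF THE CHART TRANSPORT: the insertion-table families (fine, and coarse
    -- transported by `θ_j·Q₁₀`), the generator jet and the coarse jet by their defining equations (p314580, `PeriodisedCoarseWardContact`, `NestedStepLawTorusInstanceRows`)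
    (h : ↥(pbox (fine Lc M')) × Fin (3 + 1) → ℝ) (lam : ↥(pbox (fine Lc M')) → ℝ)
    (Q₁₁ : (↥(pbox (fine Lc M')) × Fin (3 + 1) → ℝ) → Matrix (↥(pbox M') × Fin (3 + 1)) (↥(pbox (fine Lc M')) × Fin (3 + 1)) ℝ)
    (hQ₁₁ : ∀ w, Q₁₁ w = ∑ b : ↥(pbox (fine Lc M')) × Fin (3 + 1), w b •
        (perF (fine Lc M') (dper (fine Lc M') (symVhSAt (ctr (3 + 1) Lc) 3 Lc rfl b.2 (b.1 : Site (3 + 1))))).submatrix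
          (fun a : ↥(pbox M') × Fin (3 + 1) => ((coarsePt M' Lc a.1, Sum.inr a.2) : Idx (fine Lc M') (Fib 3)))
          (fun b : ↥(pbox (fine Lc M')) × Fin (3 + 1) => ((b.1, Sum.inl b.2) : Idx (fine Lc M') (Fib 3))))
    (Q₂₁ : (↥(pbox (fine Lc M')) × Fin (3 + 1) → ℝ) → Matrix κ (↥(pbox M') × Fin (3 + 1)) ℝ)
    (hQ₂₁ : ∀ w, Q₂₁ w = ∑ b : ↥(pbox (fine Lc M')) × Fin (3 + 1), w b •
        ∑ a' : ↥(pbox M') × Fin (3 + 1), (stepScale 3 Lc 1 / (stepScale 3 Lc 0 ^ 2 * ((box (3 + 1) Lc).card : ℝ)) * Q₁₀ a' b) •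
          (perF M' (dper M' (symVhSAt (ctr (3 + 1) Lc) 3 Lc rfl a'.2 (a'.1 : Site (3 + 1))))).submatrix (fun a : κ => ((pμ' a, Sum.inr (mμ' a)) : Idx M' (Fib 3)))
            (fun b : ↥(pbox M') × Fin (3 + 1) => ((b.1, Sum.inl b.2) : Idx M' (Fib 3))))
    {W₁ : Matrix (↥(pbox (fine Lc M')) × Fin (3 + 1)) (Res (ctr (3 + 1) Lc) Lc M' ⊕ Res (ctr (3 + 1) Lc) Lc (fine Lc M')) ℝ}
    (hW₁ : W₁ = ∑ b : ↥(pbox (fine Lc M')) × Fin (3 + 1), h b •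
        Matrix.of (fun (b' : ↥(pbox (fine Lc M')) × Fin (3 + 1)) (e : Res (ctr (3 + 1) Lc) Lc M' ⊕ Res (ctr (3 + 1) Lc) Lc (fine Lc M')) =>
          if b' = b then
            -((((Lc : ℝ) ^ (3 + 1) * stepScale 3 Lc 0)⁻¹)
              * Sum.elim (fun t : Res (ctr (3 + 1) Lc) Lc M' => tdelta M' (quo Lc ((b.1 : Site (3 + 1)) + unitVec b.2)) t.1)
                  (fun s : Res (ctr (3 + 1) Lc) Lc (fine Lc M') => tdelta (fine Lc M') ((b.1 : Site (3 + 1)) + unitVec b.2) s.1) e)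
          else 0))
    {Db₁ : Matrix (↥(pbox M') × Fin (3 + 1)) (Res (ctr (3 + 1) Lc) Lc M') ℝ}
    (hDb₁ : Db₁ = ∑ b : ↥(pbox (fine Lc M')) × Fin (3 + 1), h b •
        Matrix.of fun (a : ↥(pbox M') × Fin (3 + 1)) (t : Res (ctr (3 + 1) Lc) Lc M') =>
          -((((Lc : ℝ) ^ (3 + 1) * stepScale 3 Lc 0)⁻¹) * Q₁₀ a b * tdelta M' ((a.1 : Site (3 + 1)) + unitVec a.2) t.1))
    -- LEVEL 0: the first-order FORM family along `h` IS `(−2c) •` leaf-05's periodised WILSON family (`PeriodisedFormIndexWard`; an3's `wilsonA`),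
    -- the weight `−2c` forced by the generator pin `hX` (displayed binding — the dictionary's identification of the level-0 form slot, not asserted here)
    -- the Λ-SECTOR HALF of the FULL first-order (fields, fields) jet PINNED to an2 g41's Λ family of record (`CombLamSectorPeriodised`, level 0:
    -- `SLam Lc (lamCoeffOf KInv Lc) (symHessFFAt ρ_c Lc)`, periodised on (ff)), at a DISPLAYED weight `w` (the dictionary's normalisation letter)
    (w : ℝ)
    {H₁ : Matrix (↥(pbox (fine Lc M')) × Fin (3 + 1)) (↥(pbox (fine Lc M')) × Fin (3 + 1)) ℝ}
    (hH₁ : H₁ = ((-2 : ℝ) * (((Lc : ℝ) ^ (3 + 1) * stepScale 3 Lc 0)⁻¹)) • (∑ b : ↥(pbox (fine Lc M')) × Fin (3 + 1), h b •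
        (perF (fine Lc M') (dper (fine Lc M') (wilsonA 3 b.2 (b.1 : Site (3 + 1))))).submatrix
          (fun b : ↥(pbox (fine Lc M')) × Fin (3 + 1) => ((b.1, Sum.inl b.2) : Idx (fine Lc M') (Fib 3)))
          (fun b : ↥(pbox (fine Lc M')) × Fin (3 + 1) => ((b.1, Sum.inl b.2) : Idx (fine Lc M') (Fib 3))))
      + ∑ b : ↥(pbox (fine Lc M')) × Fin (3 + 1), h b •
        (w • (perF (fine Lc M') (dper (fine Lc M')
            (SLam Lc (lamCoeffOf (KInv (N := Lc) (d := 3)) Lc) (symHessFFAt (ctr (3 + 1) Lc) Lc) b.2 (b.1 : Site (3 + 1))))).submatrix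
          (fun b : ↥(pbox (fine Lc M')) × Fin (3 + 1) => ((b.1, Sum.inl b.2) : Idx (fine Lc M') (Fib 3)))
          (fun b : ↥(pbox (fine Lc M')) × Fin (3 + 1) => ((b.1, Sum.inl b.2) : Idx (fine Lc M') (Fib 3)))))
    -- LEVEL 0, ORDER 2 ((α-3)-W, an2 g42 `CombWilsonT2Periodised(K2)`): the SECOND-order FORM family along `h ⊗ h` IS `w² •` the torus bi-member of an3's
    -- order-2 Wilson table `T₂ := wilsonW₂ 3 ((8N²)⁻¹ • wsym22 N)` with its SECOND slot summed over the period copies (`hW`, an2's spelling VERBATIM), `w = −2c`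
    -- (displayed binding — the dictionary's identification of the level-0 order-2 form slot, not asserted here), PLUS a FREE ADDITIVE order-2 matrix `G`
    -- (`0` under Q-an2-g42-1 (a) — the border table is ff-free —, the Λ-companions under (b); the OWNER's word) whose parity `hGt` is DISPLAYED
    {N : ℕ} (hN : 2 ≤ N)
    {W : Fin (3 + 1) → Site (3 + 1) → Fin (3 + 1) → Site (3 + 1) → MKer (3 + 1) (Fib 3)}
    (hW : W = fun κ' u' κ u x z a c =>
      ∑' n : Site (3 + 1), wilsonW₂ 3 ((8 * (N : ℝ) ^ 2)⁻¹ • wsym22 N) κ u κ' (translate (fine Lc M') u' n) x z a c)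
    (G : Matrix (↥(pbox (fine Lc M')) × Fin (3 + 1)) (↥(pbox (fine Lc M')) × Fin (3 + 1)) ℝ) (hGt : Gᵀ = G)
    {H₂ : Matrix (↥(pbox (fine Lc M')) × Fin (3 + 1)) (↥(pbox (fine Lc M')) × Fin (3 + 1)) ℝ}
    (hH₂ : H₂ = ((-2 : ℝ) * (((Lc : ℝ) ^ (3 + 1) * stepScale 3 Lc 0)⁻¹)) ^ 2 •
        (∑ b : ↥(pbox (fine Lc M')) × Fin (3 + 1), ∑ b' : ↥(pbox (fine Lc M')) × Fin (3 + 1), (h b * h b') •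
          (perF (fine Lc M') (dper (fine Lc M') (W b'.2 (b'.1 : Site (3 + 1)) b.2 (b.1 : Site (3 + 1))))).submatrix
            (fun c : ↥(pbox (fine Lc M')) × Fin (3 + 1) => ((c.1, Sum.inl c.2) : Idx (fine Lc M') (Fib 3)))
            (fun c : ↥(pbox (fine Lc M')) × Fin (3 + 1) => ((c.1, Sum.inl c.2) : Idx (fine Lc M') (Fib 3))))
      + G)
    -- the NESTED chart's direction is average-coarse-comb-dead (the hypothesis of `torus_t1_of_average_dead`)
    (hdead : ∀ (a : ↥(pbox M') × Fin (3 + 1)) (x : Res (ctr (3 + 1) Lc) Lc M'),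
      combBondT (ctr (3 + 1) Lc) Lc M' x = ((a.1, Sum.inl a.2) : Idx M' (Fib 3)) → ∑ b : ↥(pbox (fine Lc M')) × Fin (3 + 1), Q₁₀ a b * h b = 0)
    -- ORDER 2 ON THE AVERAGING SIDE, BOUND (the OWNER d1-p3 g22's ruling on Q-d1leaf02-g22-1; my `PeriodisedSymBorderT2IndexWard(Snd)` ∕
    -- `PeriodisedSymCompositeIndexWardTwo`): the fine insertion bi-table `Q₁₂ w w′ := −c₀ • ΣΣ (w b·w′ b′) •` the second-bond-periodised border bi-member of
    -- an1's `symVh₂SAn1 3 Lc` on `F` (JA-TABLE v1.5 Δ1's weight `cB∕cVH² = −c₀`), and the coarse one `Q₂₂ w w′ := −c₁ • ΣΣ (w̄ a′·w̄′ a″) •` the same bi-member on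
    -- `M′` along the transported directions `w̄ = θ₀•Q₁₀ w` `+ Σ_{a′} (θ₀·((Q₁₁ w)·w′) a′) • Q₂₁^{a′}` (the average map's second jet) — displayed defining equations
    {W₁₂ : Fin (3 + 1) → Site (3 + 1) → Fin (3 + 1) → Site (3 + 1) → MKer (3 + 1) (Fib 3)}
    (hW₁₂ : W₁₂ = fun κ' u' κ u x z a c => ∑' n : Site (3 + 1), symVh₂SAn1 3 Lc κ u κ' (translate (fine Lc M') u' n) x z a c)
    (Q₁₂ : (↥(pbox (fine Lc M')) × Fin (3 + 1) → ℝ) → (↥(pbox (fine Lc M')) × Fin (3 + 1) → ℝ) → Matrix (↥(pbox M') × Fin (3 + 1)) (↥(pbox (fine Lc M')) × Fin (3 + 1)) ℝ)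
    (hQ₁₂ : ∀ w w', Q₁₂ w w' = -(((Lc : ℝ) ^ (3 + 1) * stepScale 3 Lc 0)⁻¹) • ∑ b : ↥(pbox (fine Lc M')) × Fin (3 + 1), ∑ b' : ↥(pbox (fine Lc M')) × Fin (3 + 1), (w b * w' b') •
        (perF (fine Lc M') (dper (fine Lc M') (W₁₂ b'.2 (b'.1 : Site (3 + 1)) b.2 (b.1 : Site (3 + 1))))).submatrix
          (fun a : ↥(pbox M') × Fin (3 + 1) => ((coarsePt M' Lc a.1, Sum.inr a.2) : Idx (fine Lc M') (Fib 3)))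
          (fun c : ↥(pbox (fine Lc M')) × Fin (3 + 1) => ((c.1, Sum.inl c.2) : Idx (fine Lc M') (Fib 3))))
    {W₂₂ : Fin (3 + 1) → Site (3 + 1) → Fin (3 + 1) → Site (3 + 1) → MKer (3 + 1) (Fib 3)}
    (hW₂₂ : W₂₂ = fun κ' u' κ u x z a c => ∑' n : Site (3 + 1), symVh₂SAn1 3 Lc κ u κ' (translate M' u' n) x z a c)
    (Q₂₂ : (↥(pbox (fine Lc M')) × Fin (3 + 1) → ℝ) → (↥(pbox (fine Lc M')) × Fin (3 + 1) → ℝ) → Matrix κ (↥(pbox M') × Fin (3 + 1)) ℝ)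
    (hQ₂₂ : ∀ w w', Q₂₂ w w' = -(((Lc : ℝ) ^ (3 + 1) * stepScale 3 Lc 1)⁻¹) • (∑ a' : ↥(pbox M') × Fin (3 + 1), ∑ a'' : ↥(pbox M') × Fin (3 + 1),
          (((stepScale 3 Lc 1 / (stepScale 3 Lc 0 ^ 2 * ((box (3 + 1) Lc).card : ℝ))) * ∑ b : ↥(pbox (fine Lc M')) × Fin (3 + 1), Q₁₀ a' b * w b) * ((stepScale 3 Lc 1 / (stepScale 3 Lc 0 ^ 2 * ((box (3 + 1) Lc).card : ℝ))) * ∑ b : ↥(pbox (fine Lc M')) × Fin (3 + 1), Q₁₀ a'' b * w' b)) •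
            (perF M' (dper M' (W₂₂ a''.2 (a''.1 : Site (3 + 1)) a'.2 (a'.1 : Site (3 + 1))))).submatrix (fun a : κ => ((pμ' a, Sum.inr (mμ' a)) : Idx M' (Fib 3)))
            (fun b : ↥(pbox M') × Fin (3 + 1) => ((b.1, Sum.inl b.2) : Idx M' (Fib 3))))
        + ∑ a' : ↥(pbox M') × Fin (3 + 1), ((stepScale 3 Lc 1 / (stepScale 3 Lc 0 ^ 2 * ((box (3 + 1) Lc).card : ℝ))) * ∑ b' : ↥(pbox (fine Lc M')) × Fin (3 + 1), Q₁₁ w a' b' * w' b') •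
          (perF M' (dper M' (symVhSAt (ctr (3 + 1) Lc) 3 Lc rfl a'.2 (a'.1 : Site (3 + 1))))).submatrix (fun a : κ => ((pμ' a, Sum.inr (mμ' a)) : Idx M' (Fib 3)))
            (fun b : ↥(pbox M') × Fin (3 + 1) => ((b.1, Sum.inl b.2) : Idx M' (Fib 3))))
    -- leaf-06's EXPONENTIAL closed form of the nested chart's generator SECOND jet along `h` (`TorusGeneratorIntertwiningTwo.torus_j2`'s `hW₂`)
    {W₂ : Matrix (↥(pbox (fine Lc M')) × Fin (3 + 1)) (Res (ctr (3 + 1) Lc) Lc M' ⊕ Res (ctr (3 + 1) Lc) Lc (fine Lc M')) ℝ}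
    (hW₂ : W₂ = Matrix.of fun (b : ↥(pbox (fine Lc M')) × Fin (3 + 1)) (e : Res (ctr (3 + 1) Lc) Lc M' ⊕ Res (ctr (3 + 1) Lc) Lc (fine Lc M')) =>
        ((((Lc : ℝ) ^ (3 + 1) * stepScale 3 Lc 0)⁻¹) * h b) ^ 2 * Sum.elim (fun t : Res (ctr (3 + 1) Lc) Lc M' => tdelta M' (quo Lc ((b.1 : Site (3 + 1)) + unitVec b.2)) t.1)
          (fun s : Res (ctr (3 + 1) Lc) Lc (fine Lc M') => tdelta (fine Lc M') ((b.1 : Site (3 + 1)) + unitVec b.2) s.1) e)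
    (Db₂ : Matrix (↥(pbox M') × Fin (3 + 1)) (Res (ctr (3 + 1) Lc) Lc M') ℝ)
    (Y₁ Y₂ : Matrix κ (Res (ctr (3 + 1) Lc) Lc M' ⊕ Res (ctr (3 + 1) Lc) Lc (fine Lc M')) ℝ)
    -- the chart transport (exponential currency): generators `X` (fields), `X̄` (composite multipliers); the one-shot chart's generator jets `W♯₁ W♯₂`;
    -- the parameter-transport jets `C₁ C₂`
    {X : Matrix (↥(pbox (fine Lc M')) × Fin (3 + 1)) (↥(pbox (fine Lc M')) × Fin (3 + 1)) ℝ} {Xbar : Matrix κ κ ℝ}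
    -- (T-β-1) at the torus: the transport generators ARE the diagonal gauge generators of the parameter `λ` (fields: `−c•E_λ`; composite multipliers: `c•R′_λ̄`)
    (hX : X = -((((Lc : ℝ) ^ (3 + 1) * stepScale 3 Lc 0)⁻¹) • Matrix.diagonal (fun b : ↥(pbox (fine Lc M')) × Fin (3 + 1) => lam b.1)))
    (hXbar : Xbar = (((Lc : ℝ) ^ (3 + 1) * stepScale 3 Lc 0)⁻¹) •
        Matrix.diagonal (fun α : κ => ∑ t : ↥(pbox M'), tdelta M' ((pμ' α : Site (3 + 1)) + ctr (3 + 1) Lc) t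
          * (∑ s : ↥(pbox (fine Lc M')), tdelta (fine Lc M') ((Lc : ℤ) • (t : Site (3 + 1)) + ctr (3 + 1) Lc) s * lam s)))
    -- (T-β-4) AT THE TORUS (leaf-06 `TorusGeneratorIntertwining`): the one-shot chart's generator first jet IS the nested chart's generator jet ALONG THE
    -- GAUGE-SHIFTED DIRECTION `h + Dλ`, by its defining equation in closed form (`weightedJet_eq` currency)
    {W'₁ : Matrix (↥(pbox (fine Lc M')) × Fin (3 + 1)) (Res (ctr (3 + 1) Lc) Lc M' ⊕ Res (ctr (3 + 1) Lc) Lc (fine Lc M')) ℝ}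
    (hW'₁ : W'₁ = Matrix.of fun (b : ↥(pbox (fine Lc M')) × Fin (3 + 1)) (e : Res (ctr (3 + 1) Lc) Lc M' ⊕ Res (ctr (3 + 1) Lc) Lc (fine Lc M')) =>
        -((((Lc : ℝ) ^ (3 + 1) * stepScale 3 Lc 0)⁻¹) * (h b + ∑ s, tgrad (fine Lc M') (b.1, Sum.inl b.2) s * lam s)
          * Sum.elim (fun t : Res (ctr (3 + 1) Lc) Lc M' => tdelta M' (quo Lc ((b.1 : Site (3 + 1)) + unitVec b.2)) t.1)
            (fun s : Res (ctr (3 + 1) Lc) Lc (fine Lc M') => tdelta (fine Lc M') ((b.1 : Site (3 + 1)) + unitVec b.2) s.1) e))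
    -- the one-shot chart's generator SECOND jet along `h + Dλ`, exponential closed form (`torus_j2`'s `hW₂'`, `torus_uP_exp`'s `hW₂` at `w := h + Dλ`)
    {W'₂ : Matrix (↥(pbox (fine Lc M')) × Fin (3 + 1)) (Res (ctr (3 + 1) Lc) Lc M' ⊕ Res (ctr (3 + 1) Lc) Lc (fine Lc M')) ℝ}
    (hW'₂ : W'₂ = Matrix.of fun (b : ↥(pbox (fine Lc M')) × Fin (3 + 1)) (e : Res (ctr (3 + 1) Lc) Lc M' ⊕ Res (ctr (3 + 1) Lc) Lc (fine Lc M')) =>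
        ((((Lc : ℝ) ^ (3 + 1) * stepScale 3 Lc 0)⁻¹) * (h b + ∑ s, tgrad (fine Lc M') (b.1, Sum.inl b.2) s * lam s)) ^ 2
          * Sum.elim (fun t : Res (ctr (3 + 1) Lc) Lc M' => tdelta M' (quo Lc ((b.1 : Site (3 + 1)) + unitVec b.2)) t.1)
            (fun s : Res (ctr (3 + 1) Lc) Lc (fine Lc M') => tdelta (fine Lc M') ((b.1 : Site (3 + 1)) + unitVec b.2) s.1) e)
    -- the parameter-transport GENERATOR `C₁(λ)` by leaf-06's defining equation `hC₁` VERBATIM («multiplication by `λ` in the gauge-mode basis»: `diagonal λ̄`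
    -- on the coarse residual parameters, `diagonal (λ∘val)` on the fine ones, coarse-to-fine block `(λ s − λ̄ t)·[block s = t]`); the transport is `c • C₁`
    {C₁ : Matrix (Res (ctr (3 + 1) Lc) Lc M' ⊕ Res (ctr (3 + 1) Lc) Lc (fine Lc M')) (Res (ctr (3 + 1) Lc) Lc M' ⊕ Res (ctr (3 + 1) Lc) Lc (fine Lc M')) ℝ}
    (hC₁ : C₁ = Matrix.fromBlocks
        (Matrix.diagonal fun t : Res (ctr (3 + 1) Lc) Lc M' =>
          ∑ s, tdelta (fine Lc M') ((Lc : ℤ) • ((t.1 : ↥(pbox M')) : Site (3 + 1)) + ctr (3 + 1) Lc) s * lam s)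
        (0 : Matrix (Res (ctr (3 + 1) Lc) Lc M') (Res (ctr (3 + 1) Lc) Lc (fine Lc M')) ℝ)
        (Matrix.of fun (s : Res (ctr (3 + 1) Lc) Lc (fine Lc M')) (t : Res (ctr (3 + 1) Lc) Lc M') =>
          (lam s.1 - ∑ s', tdelta (fine Lc M') ((Lc : ℤ) • ((t.1 : ↥(pbox M')) : Site (3 + 1)) + ctr (3 + 1) Lc) s' * lam s')
            * tdelta M' (quo Lc ((s.1 : ↥(pbox (fine Lc M'))) : Site (3 + 1))) t.1)
        (Matrix.diagonal fun s : Res (ctr (3 + 1) Lc) Lc (fine Lc M') => lam s.1))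
    {𝔔₀ 𝔔₁ 𝔔₂ : Matrix κ (↥(pbox (fine Lc M')) × Fin (3 + 1)) ℝ}
    (h𝔔₀ : Q₂₀ * Q₁₀ = 𝔔₀) (h𝔔₁ : Q₂₁ h * Q₁₀ + Q₂₀ * Q₁₁ h = 𝔔₁)
    (h𝔔₂ : Q₂₂ h h * Q₁₀ + Q₂₁ h * Q₁₁ h + (Q₂₁ h * Q₁₁ h + Q₂₀ * Q₁₂ h h) = 𝔔₂)
    -- (T-β-1) GRADED, ORDER 2, LEVEL 0: the ONE-SHOT literal's second form jet NAMED by the `k2` word (`k2` DISCHARGED: an2 `torus_k2_sim_letter`) —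
    -- `w² •` the Wilson bi-member along the GAUGE-SHIFTED pair `(h + Dλ) ⊗ (h + Dλ)`, PLUS the commutator of the Λ half of `H₁` with the generator
    -- `E_λ` (weight `w`), PLUS `G` un-shifted (representative (a) of Q-an2-g42-1; no order-2 index law asserted)
    {H'₂ : Matrix (↥(pbox (fine Lc M')) × Fin (3 + 1)) (↥(pbox (fine Lc M')) × Fin (3 + 1)) ℝ}
    (hH'₂ : H'₂ = ((-2 : ℝ) * (((Lc : ℝ) ^ (3 + 1) * stepScale 3 Lc 0)⁻¹)) ^ 2 •
        (∑ b : ↥(pbox (fine Lc M')) × Fin (3 + 1), ∑ b' : ↥(pbox (fine Lc M')) × Fin (3 + 1),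
          ((h b + ∑ s : ↥(pbox (fine Lc M')), tgrad (fine Lc M') (b.1, Sum.inl b.2) s * lam s)
            * (h b' + ∑ s : ↥(pbox (fine Lc M')), tgrad (fine Lc M') (b'.1, Sum.inl b'.2) s * lam s)) •
          (perF (fine Lc M') (dper (fine Lc M') (W b'.2 (b'.1 : Site (3 + 1)) b.2 (b.1 : Site (3 + 1))))).submatrix
            (fun c : ↥(pbox (fine Lc M')) × Fin (3 + 1) => ((c.1, Sum.inl c.2) : Idx (fine Lc M') (Fib 3)))
            (fun c : ↥(pbox (fine Lc M')) × Fin (3 + 1) => ((c.1, Sum.inl c.2) : Idx (fine Lc M') (Fib 3))))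
      + ((-2 : ℝ) * (((Lc : ℝ) ^ (3 + 1) * stepScale 3 Lc 0)⁻¹)) •
        ((∑ b : ↥(pbox (fine Lc M')) × Fin (3 + 1), h b •
            (w • (perF (fine Lc M') (dper (fine Lc M')
              (SLam Lc (lamCoeffOf (KInv (N := Lc) (d := 3)) Lc) (symHessFFAt (ctr (3 + 1) Lc) Lc) b.2 (b.1 : Site (3 + 1))))).submatrix
            (fun b : ↥(pbox (fine Lc M')) × Fin (3 + 1) => ((b.1, Sum.inl b.2) : Idx (fine Lc M') (Fib 3)))
            (fun b : ↥(pbox (fine Lc M')) × Fin (3 + 1) => ((b.1, Sum.inl b.2) : Idx (fine Lc M') (Fib 3)))))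
          * Matrix.diagonal (fun b : ↥(pbox (fine Lc M')) × Fin (3 + 1) => lam b.1)
        - Matrix.diagonal (fun b : ↥(pbox (fine Lc M')) × Fin (3 + 1) => lam b.1)
          * (∑ b : ↥(pbox (fine Lc M')) × Fin (3 + 1), h b •
            (w • (perF (fine Lc M') (dper (fine Lc M')
              (SLam Lc (lamCoeffOf (KInv (N := Lc) (d := 3)) Lc) (symHessFFAt (ctr (3 + 1) Lc) Lc) b.2 (b.1 : Site (3 + 1))))).submatrix
            (fun b : ↥(pbox (fine Lc M')) × Fin (3 + 1) => ((b.1, Sum.inl b.2) : Idx (fine Lc M') (Fib 3)))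
            (fun b : ↥(pbox (fine Lc M')) × Fin (3 + 1) => ((b.1, Sum.inl b.2) : Idx (fine Lc M') (Fib 3))))))
      + G)
    -- LEVEL 0: the ONE-SHOT literal's first form jet IS the same weighted Wilson family along the GAUGE-SHIFTED direction `h + Dλ` (`k1` DISCHARGED:
    -- leaf-05 `torus_k1_sim_letter`)
    {H'₁ : Matrix (↥(pbox (fine Lc M')) × Fin (3 + 1)) (↥(pbox (fine Lc M')) × Fin (3 + 1)) ℝ}
    (hH'₁ : H'₁ = ((-2 : ℝ) * (((Lc : ℝ) ^ (3 + 1) * stepScale 3 Lc 0)⁻¹)) • (∑ b : ↥(pbox (fine Lc M')) × Fin (3 + 1),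
        (h b + ∑ s : ↥(pbox (fine Lc M')), tgrad (fine Lc M') (b.1, Sum.inl b.2) s * lam s) •
          (perF (fine Lc M') (dper (fine Lc M') (wilsonA 3 b.2 (b.1 : Site (3 + 1))))).submatrix
          (fun b : ↥(pbox (fine Lc M')) × Fin (3 + 1) => ((b.1, Sum.inl b.2) : Idx (fine Lc M') (Fib 3)))
          (fun b : ↥(pbox (fine Lc M')) × Fin (3 + 1) => ((b.1, Sum.inl b.2) : Idx (fine Lc M') (Fib 3))))
      + ∑ b : ↥(pbox (fine Lc M')) × Fin (3 + 1), (h b + ∑ s : ↥(pbox (fine Lc M')), tgrad (fine Lc M') (b.1, Sum.inl b.2) s * lam s) •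
        (w • (perF (fine Lc M') (dper (fine Lc M')
            (SLam Lc (lamCoeffOf (KInv (N := Lc) (d := 3)) Lc) (symHessFFAt (ctr (3 + 1) Lc) Lc) b.2 (b.1 : Site (3 + 1))))).submatrix
          (fun b : ↥(pbox (fine Lc M')) × Fin (3 + 1) => ((b.1, Sum.inl b.2) : Idx (fine Lc M') (Fib 3)))
          (fun b : ↥(pbox (fine Lc M')) × Fin (3 + 1) => ((b.1, Sum.inl b.2) : Idx (fine Lc M') (Fib 3)))))
    {𝔔'₁ 𝔔'₂ : Matrix κ (↥(pbox (fine Lc M')) × Fin (3 + 1)) ℝ}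
    -- `q1` DISCHARGED (`PeriodisedCompositeIndexWard.torus_q1_letter`): the one-shot literal's first composite averaging jet IS the composite insertion jet
    -- along the GAUGE-SHIFTED direction `h + Dλ`, NAMED
    (h𝔔'₁ : Q₂₁ (fun b => h b + ∑ s : ↥(pbox (fine Lc M')), tgrad (fine Lc M') (b.1, Sum.inl b.2) s * lam s) * Q₁₀
        + Q₂₀ * Q₁₁ (fun b => h b + ∑ s : ↥(pbox (fine Lc M')), tgrad (fine Lc M') (b.1, Sum.inl b.2) s * lam s) = 𝔔'₁)
    -- `q2` DISCHARGED (`PeriodisedSymCompositeIndexWardTwo.torus_q2_sym_letter`): the one-shot literal's SECOND composite averaging jet NAMED — the bi-member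
    -- summands along `h′ = h + Dλ` (`w̄′ = θ₀•Q₁₀ h′`), the average map's second-jet summand UN-SHIFTED (the letter's displayed (★); the OWNER's (TN) word)
    (h𝔔'₂ : (-(((Lc : ℝ) ^ (3 + 1) * stepScale 3 Lc 1)⁻¹) • (∑ a' : ↥(pbox M') × Fin (3 + 1), ∑ a'' : ↥(pbox M') × Fin (3 + 1),
            (((stepScale 3 Lc 1 / (stepScale 3 Lc 0 ^ 2 * ((box (3 + 1) Lc).card : ℝ))) * ∑ b : ↥(pbox (fine Lc M')) × Fin (3 + 1), Q₁₀ a' b * (h b + ∑ s : ↥(pbox (fine Lc M')), tgrad (fine Lc M') (b.1, Sum.inl b.2) s * lam s))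
              * ((stepScale 3 Lc 1 / (stepScale 3 Lc 0 ^ 2 * ((box (3 + 1) Lc).card : ℝ))) * ∑ b : ↥(pbox (fine Lc M')) × Fin (3 + 1), Q₁₀ a'' b * (h b + ∑ s : ↥(pbox (fine Lc M')), tgrad (fine Lc M') (b.1, Sum.inl b.2) s * lam s))) •
              (perF M' (dper M' (W₂₂ a''.2 (a''.1 : Site (3 + 1)) a'.2 (a'.1 : Site (3 + 1))))).submatrix (fun a : κ => ((pμ' a, Sum.inr (mμ' a)) : Idx M' (Fib 3)))
            (fun b : ↥(pbox M') × Fin (3 + 1) => ((b.1, Sum.inl b.2) : Idx M' (Fib 3))))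
          + ∑ a' : ↥(pbox M') × Fin (3 + 1), ((stepScale 3 Lc 1 / (stepScale 3 Lc 0 ^ 2 * ((box (3 + 1) Lc).card : ℝ))) * ∑ b' : ↥(pbox (fine Lc M')) × Fin (3 + 1), Q₁₁ h a' b' * h b') •
            (perF M' (dper M' (symVhSAt (ctr (3 + 1) Lc) 3 Lc rfl a'.2 (a'.1 : Site (3 + 1))))).submatrix (fun a : κ => ((pμ' a, Sum.inr (mμ' a)) : Idx M' (Fib 3)))
            (fun b : ↥(pbox M') × Fin (3 + 1) => ((b.1, Sum.inl b.2) : Idx M' (Fib 3)))) * Q₁₀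
        + Q₂₁ (fun b => h b + ∑ s : ↥(pbox (fine Lc M')), tgrad (fine Lc M') (b.1, Sum.inl b.2) s * lam s) * Q₁₁ (fun b => h b + ∑ s : ↥(pbox (fine Lc M')), tgrad (fine Lc M') (b.1, Sum.inl b.2) s * lam s)
        + (Q₂₁ (fun b => h b + ∑ s : ↥(pbox (fine Lc M')), tgrad (fine Lc M') (b.1, Sum.inl b.2) s * lam s) * Q₁₁ (fun b => h b + ∑ s : ↥(pbox (fine Lc M')), tgrad (fine Lc M') (b.1, Sum.inl b.2) s * lam s)
          + Q₂₀ * Q₁₂ (fun b => h b + ∑ s : ↥(pbox (fine Lc M')), tgrad (fine Lc M') (b.1, Sum.inl b.2) s * lam s) (fun b => h b + ∑ s : ↥(pbox (fine Lc M')), tgrad (fine Lc M') (b.1, Sum.inl b.2) s * lam s)) = 𝔔'₂)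
    -- (T-β-4) `j1 j2 uC` and the one-shot (UNI)-jet letter `uP'` DISCHARGED (leaf-06); dead rows of the nested chart stay: the small comb rows, and
    -- the order-2 coarse comb row of the average (`t1` DISCHARGED)
    (t2 : τ₂ * (Q₁₂ h h * fromCols D₂ D₁ + (2 : ℝ) • (Q₁₁ h * W₁) + Q₁₀ * W₂) = 0)
    -- (`hH₂t` DISCHARGED: an2 `torus_H2_transpose` + the displayed `hGt`)
    -- the GRADED second-order composite Ward TABLE IDENTITIES (δ-constrained: `𝔎 = H`; the door's one-sided graded shapes, `W₀ := [D₂ | D₁]`), read at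
    -- `Y₀ = 0`; orders 1 and 2 only (order 0 `a0` DISCHARGED: `PeriodisedWardOrderZero.torus_a0_letter`); NO transposed rows
    (a1 : H₁ * fromCols D₂ D₁ + H₀ * W₁ = 𝔔₀ᵀ * Y₁)
    (a2 : H₂ * fromCols D₂ D₁ + (2 : ℝ) • (H₁ * W₁) + H₀ * W₂ = -((2 : ℝ) • (𝔔₁ᵀ * Y₁)) + 𝔔₀ᵀ * Y₂)
    -- the insertion-table covariance TABLE IDENTITIES and the coarse covariance identities (order 0 discharged in p316503)
    -- order 2 only (order 1 `c1 d1` DISCHARGED: p314580, `PeriodisedCoarseWardContact`)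
    (c2 : Q₁₂ h h * fromCols D₂ D₁ + (2 : ℝ) • (Q₁₁ h * W₁) + Q₁₀ * W₂ = fromCols Db₂ 0)
    (d2 : Q₂₂ h h * Dbar + (2 : ℝ) • (Q₂₁ h * Db₁) + Q₂₀ * Db₂ = 0)
    -- block namings and the coarse non-degeneracy
    {Γ : Matrix (↥(pbox (fine Lc M')) × Fin (3 + 1)) (↥(pbox (fine Lc M')) × Fin (3 + 1)) ℝ}
    {I : Matrix (↥(pbox (fine Lc M')) × Fin (3 + 1)) ((↥(pbox M') × Fin (3 + 1)) ⊕ Res (ctr (3 + 1) Lc) Lc (fine Lc M')) ℝ}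
    {L : Matrix ((↥(pbox M') × Fin (3 + 1)) ⊕ Res (ctr (3 + 1) Lc) Lc (fine Lc M')) (↥(pbox (fine Lc M')) × Fin (3 + 1)) ℝ}
    {S : Matrix ((↥(pbox M') × Fin (3 + 1)) ⊕ Res (ctr (3 + 1) Lc) Lc (fine Lc M')) ((↥(pbox M') × Fin (3 + 1)) ⊕ Res (ctr (3 + 1) Lc) Lc (fine Lc M')) ℝ}
    {B : Matrix ((↥(pbox M') × Fin (3 + 1)) ⊕ Res (ctr (3 + 1) Lc) Lc (fine Lc M')) (↥(pbox (fine Lc M')) × Fin (3 + 1)) ℝ}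
    (hΓ : flucCov H₀ (fromRows Q₁₀ τ₁) = Γ) (hI : minOp H₀ (fromRows Q₁₀ τ₁) = I) (hL : minOpL H₀ (fromRows Q₁₀ τ₁) = L) (hS : effForm H₀ (fromRows Q₁₀ τ₁) = S)
    (hB : fromRows (Q₁₁ h) (0 : Matrix (Res (ctr (3 + 1) Lc) Lc (fine Lc M')) (↥(pbox (fine Lc M')) × Fin (3 + 1)) ℝ) = B) :
    secondVar (kkt H₀ (fromRows 𝔔₀ P))
        (fromBlocks H'₁ (-(fromRows 𝔔'₁ (0 : Matrix (Res (ctr (3 + 1) Lc) Lc M' ⊕ Res (ctr (3 + 1) Lc) Lc (fine Lc M')) (↥(pbox (fine Lc M')) × Fin (3 + 1)) ℝ))ᵀ)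
          (fromRows 𝔔'₁ (0 : Matrix (Res (ctr (3 + 1) Lc) Lc M' ⊕ Res (ctr (3 + 1) Lc) Lc (fine Lc M')) (↥(pbox (fine Lc M')) × Fin (3 + 1)) ℝ)) 0)
        (kkt H'₂ (fromRows 𝔔'₂ (0 : Matrix (Res (ctr (3 + 1) Lc) Lc M' ⊕ Res (ctr (3 + 1) Lc) Lc (fine Lc M')) (↥(pbox (fine Lc M')) × Fin (3 + 1)) ℝ)))
      = secondVar (kkt H₀ (fromRows Q₁₀ τ₁)) (fromBlocks H₁ (-Bᵀ) B 0)
            (kkt H₂ (fromRows (Q₁₂ h h) (0 : Matrix (Res (ctr (3 + 1) Lc) Lc (fine Lc M')) (↥(pbox (fine Lc M')) × Fin (3 + 1)) ℝ)))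
        + secondVar
            (kkt S.toBlocks₁₁ (fromRows Q₂₀ τ₂))
            (fromBlocks ((L * H₁ - S * B) * I + L * Bᵀ * S).toBlocks₁₁ (-(fromRows (Q₂₁ h) (0 : Matrix (Res (ctr (3 + 1) Lc) Lc M') (↥(pbox M') × Fin (3 + 1)) ℝ))ᵀ)
              (fromRows (Q₂₁ h) (0 : Matrix (Res (ctr (3 + 1) Lc) Lc M') (↥(pbox M') × Fin (3 + 1)) ℝ)) 0)
            (kkt (((-((L * H₁ - S * B) * Γ - L * Bᵀ * L) * H₁ + L * H₂
                      - (((L * H₁ - S * B) * I + L * Bᵀ * S) * B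
                          + S * fromRows (Q₁₂ h h) (0 : Matrix (Res (ctr (3 + 1) Lc) Lc (fine Lc M')) (↥(pbox (fine Lc M')) × Fin (3 + 1)) ℝ))) * I
                    + (L * H₁ - S * B) * (-((Γ * H₁ + I * B) * I + Γ * Bᵀ * S)))
                  - ((-((L * H₁ - S * B) * Γ - L * Bᵀ * L) * (-Bᵀ)
                        + L * (fromRows (Q₁₂ h h) (0 : Matrix (Res (ctr (3 + 1) Lc) Lc (fine Lc M')) (↥(pbox (fine Lc M')) × Fin (3 + 1)) ℝ))ᵀ) * S
                      + L * (-Bᵀ) * ((L * H₁ - S * B) * I + L * Bᵀ * S))).toBlocks₁₁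
              (fromRows (Q₂₂ h h) (0 : Matrix (Res (ctr (3 + 1) Lc) Lc M') (↥(pbox M') × Fin (3 + 1)) ℝ))) :=
  secondVar_oneShot_nestedStepLaw_torus_transported_graded_rows_levelZero_sym_uLow_closed_lam_w2 M' hM' pμ' mμ' hfμ' hcoarse' hH₀ hQ₁₀ hτ₁ hτ₂ hD₁ hD₂
    hDbar hP hQ₂₀ h lam Q₁₁ hQ₁₁ Q₂₁ hQ₂₁ hW₁ hDb₁ w hH₁ hN hW G hGt hH₂ hdead (Q₁₂ h h) (Q₂₂ h h) hW₂ Db₂ Y₁ Y₂ hX hXbar hW'₁ hW'₂ hC₁ h𝔔₀ h𝔔₁ h𝔔₂ hH'₂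
    hH'₁ h𝔔'₁
    -- `q2` BY TERM: the letter, then the displayed naming `h𝔔'₂`
    ((torus_q2_sym_letter M' hM' 0 h lam pμ' mμ' hQ₁₀ hQ₂₀ Q₁₁ hQ₁₁ Q₂₁ hQ₂₁ hW₁₂ Q₁₂ hQ₁₂ hW₂₂ Q₂₂ hQ₂₂ hX hXbar h𝔔₀ h𝔔₁ h𝔔₂).trans h𝔔'₂)
    t2 a1 a2 c2 d2 hΓ hI hL hS hB

end Summit.QuantumFields.BalabanUV.Beta.FP.NestedStepLawTorusTransportedRowsGradedLevelZeroSymULowClosedLamW2Q2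

end
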